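import Summits.MatrixMultiplication.MatrixMultiplication.Theorems.ObstructionDescentUniversalOccurrenceKronecker
import Literature.Computability.AlgebraicComplexity.KroneckerPolytopeTangentMap

/-!
# Obstruction descent — universal occurrence, VIII: short legs are free (the mixed-fill reduction)

Route `ObstructionDescent` (sub-problem `MatrixMultiplication`), node `NoOccurrenceObstruction` (`P_O`), line
`UOCC(m,N)` ("`K(N,N,N) ⊆ S(⟨m⟩)`", NODE-g29…g33 of the decomp-mm cell, lens 3).  Closure currency throughout: "the
triple `λ` occurs for the tensor `s`" is `isotypicSum₁ λ⁰ (isotypicSum₂ λ¹ (isotypicSum₃ λ² (s^{⊗d}))) ≠ 0`.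

**The reduction.**  Write `N' = N + 1` for the format.  A partition triple `λ = (λ⁰, λ¹, λ²)` occurring for some tensor
of format `N'` whose leg `j` has at most `N` parts already occurs for a tensor of format `N'` VANISHING ON THE LAST SLICE of
leg `j` (`exists_occurs_avoiding_last_of_kroneckerCoeff_pos`: a highest-weight vector of weight `λʲ` in the word model is
supported on words of content `λʲ`, which do not use the letter `N` when `λʲ` has `≤ N` parts, so the symmetric word
polynomial witnessing `g(λ) > 0` does not involve the coordinates of the last slice, and its non-vanishing point may be
taken there equal to zero).  Hence, if every tensor of format `N'` vanishing on the last slice of one leg has border rank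
`≤ m` (the secant variety `σ_m` FILLS the sub-formats `N × N' × N'`, `N' × N × N'`, `N' × N' × N`), every such triple occurs
in `⟨m⟩` (`occurs_unitTensor_of_shortLeg`), and `UOCC(m, N')` is equivalent to its restriction to triples all of whose
legs have exactly `N'` parts (`uocc_iff_fullRow`).

**The cell `(m,N') = (6,4)`** (`u(4) ∈ {6,7}`, NODE-g32 §3): `σ₆` fills `3×4×4` (Terracini: the Jacobian of the
parametrisation of `σ₆(3,4,4)` at a random integer point has rank `48`, NODE-g33 data `terracini.py`; classical typical rank
`6` of `3×4×4`), so `UOCC(6,4)` — equivalently `u(4) = 6` — is decided on the triples with three legs of exactly four parts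
(`uocc_six_four_iff_fullRow`, hypothesis = the three fills, literal).  Combined with the generator criterion
(`kroneckerSemigroup_le_iff_generators`, part VI) and `I(σ₆(4,4,4))_{<19} = 0` [HauensteinIkenmeyerLandsberg2013] the
open content of the cell is the finite list of ALL-FOUR-ROW Hilbert-basis elements of `K(4,4,4)` of degree `≥ 19`
(NODE-g33 §2: none in degrees 19, 21, 22, 23; eleven in degree 20, all containing the leg `(5,5,5,5)`; one in degree 24).

## References
* [BurgisserIkenmeyer2011] P. Bürgisser, C. Ikenmeyer, *Geometric complexity theory and tensor rank*, STOC 2011 /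
  arXiv:1011.1350, §3.1–3.2 (semigroup of a tensor, inheritance), Lemma 10.18.
* [HauensteinIkenmeyerLandsberg2013] J. Hauenstein, C. Ikenmeyer, J.M. Landsberg, *Equations for lower bounds on border
  rank*, Exp. Math. 22 (2013), arXiv:1305.0779, §1 (no equations of degree `< 19` on `σ_{6;4,4,4}`).
* [AboOttavianiPeterson2008] H. Abo, G. Ottaviani, C. Peterson, *Induction for secant varieties of Segre varieties*,
  Trans. AMS 361 (2009), §4 (`σ₆(ℙ²×ℙ³×ℙ³)` fills; `σ₅` is defective).
* [FultonHarrisGTM129] W. Fulton, J. Harris, *Representation Theory*, §15.5 (weights of the word model).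
-/

noncomputable section

open scoped BigOperators
open MvPolynomial

namespace Summit.MatrixMultiplication.MatrixMultiplication.Theorems.ObstructionCalculus

open Literature.Computability.AlgebraicComplexity (actTensor kroneckerPow isotypicSum₁ isotypicSum₂ isotypicSum₃
  unitTensor algBorderRank TensorRestrictsTo tensorRestrictsTo_actTensor
  isotypicSum₁₂₃_kroneckerPow_ne_zero_of_pairing_tripleHw_ne_zero kroneckerPow_apply prod_X_eq_monomial_wordExp)
open Literature.NumberTheory.DiophantineGeometry (Word Word3 wordRep highestWeightSpace Weight wordContent wordPoly
  zip3 zip3_symm_comp permute3 tripleHw mem_tripleHw_iff kroneckerCoeff exists_invariant_of_kroneckerCoeff_pos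
  eq_zero_of_wordPoly_eq_zero apply_eq_zero_of_mem_highestWeightSpace)

/-! ## §1  A single tensor of border rank `≤ m` passes its triples to `⟨m⟩` -/

/-- **Border rank `≤ m` gives `S(s) ⊆ S(⟨m⟩)`** for one tensor `s` of format `N ≤ m` (the single-tensor form of
`uocc_of_forall_algBorderRank_le`, part I): pad `s` to format `m`; `I(GL_m³·⟨m⟩) ⊆ I(GL_m³·pad s)`
(`orbitVanishing_unitTensor_le_of_algBorderRank_le`) and calculus containment gives semigroup containment.
[cite: BurgisserIkenmeyer2011, §3.1, Lemma 10.18] -/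
theorem occurs_unitTensor_of_algBorderRank_le {m N : ℕ} (hNm : N ≤ m) (s : Fin N → Fin N → Fin N → ℂ)
    (hbr : algBorderRank s ≤ m) (d : ℕ) (lam : Fin 3 → Nat.Partition d)
    (hocc : isotypicSum₁ (lam 0) (isotypicSum₂ (lam 1) (isotypicSum₃ (lam 2) (kroneckerPow s d))) ≠ 0) :
    isotypicSum₁ (lam 0) (isotypicSum₂ (lam 1) (isotypicSum₃ (lam 2) (kroneckerPow (unitTensor ℂ m) d))) ≠ 0 := by
  classical
  have he : Function.Injective (fun i : Fin N => Fin.castLE hNm i) := fun i j hij => Fin.castLE_injective hNm hij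
  have hocc' := (isotypicSum_kroneckerPow_padTensor_ne_zero_iff he s lam).2 hocc
  have hbr' : algBorderRank (padTensor (fun i : Fin N => Fin.castLE hNm i) s) ≤ m := by
    rw [padTensor_eq_actTensor_ind]
    exact (tensorRestrictsTo_actTensor _ _ _ s).algBorderRank_le.trans hbr
  have horb := orbitVanishing_unitTensor_le_of_algBorderRank_le hbr'
  exact isotypicSum_ne_zero_imp_of_hwvSpace_le_imp (unitTensor ℂ m) _ (fun d Λ hle => hle.trans horb) d lam hocc'

/-! ## §2  A triple with a short leg occurs for a tensor vanishing on the last slice of that leg -/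

/-- The weight of a partition with at most `N` parts, read in `GL_{N+1}`, vanishes at the last index. [folklore] -/
theorem weight_ofPartition_last_eq_zero {N d : ℕ} {μ : Nat.Partition d} (h : μ.parts.card ≤ N) :
    Weight.ofPartition (N + 1) μ (Fin.last N) = 0 := by
  have hlen : μ.sortedParts.length ≤ N := by rw [Nat.Partition.length_sortedParts]; exact h
  simp [Weight.ofPartition, List.getElem?_eq_none_iff.mpr hlen]

/-- A word using the letter `i` has positive content at `i`. [folklore] -/
theorem wordContent_ne_zero_of_apply_eq {N n : ℕ} {w : Word N n} {p : Fin n} {i : Fin N} (h : w p = i) :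
    wordContent w i ≠ 0 := by
  unfold wordContent
  exact Finset.card_ne_zero.2 ⟨p, by simp [h]⟩

/-- A highest-weight vector of weight `λ` (a partition with `≤ N` parts) in the word model on `N+1` letters is supported
on words avoiding the last letter. [cite: FultonHarrisGTM129, §15.5] -/
theorem apply_ne_last_of_mem_highestWeightSpace {N n d : ℕ} {μ : Nat.Partition d} (hμ : μ.parts.card ≤ N)
    {ξ : Word (N + 1) n → ℂ} (hξ : ξ ∈ highestWeightSpace (wordRep ℂ (N + 1) n) (Weight.ofPartition (N + 1) μ))
    {w : Word (N + 1) n} (hw : ξ w ≠ 0) (p : Fin n) : w p ≠ Fin.last N := by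
  intro hp
  apply hw
  apply apply_eq_zero_of_mem_highestWeightSpace ℂ hξ (i := Fin.last N)
  rw [weight_ofPartition_last_eq_zero hμ]
  exact_mod_cast wordContent_ne_zero_of_apply_eq hp

/-- **A positive Kronecker coefficient is witnessed by a tensor vanishing on the last slice of every short leg.**
If `g(λ⁰,λ¹,λ²) > 0` for partitions with at most `N+1` parts, the triple occurs in `s^{⊗n}` for some tensor
`s ∈ ℂ^{N+1} ⊗ ℂ^{N+1} ⊗ ℂ^{N+1}` which, for every leg `j` with `λʲ` of at most `N` parts, vanishes on the last slice
of leg `j` (so the triple lives on the sub-format with `N` in place of `N+1` on those legs).  Proof: as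
`exists_occurs_of_kroneckerCoeff_pos`, plus the support of highest-weight vectors (`apply_ne_last_of_mem_highestWeightSpace`):
the symmetric word polynomial of the invariant `M ∈ HW ⊗ HW ⊗ HW` does not involve the variables of those slices.
[cite: BurgisserIkenmeyer2011, §3.1–3.2] [cite: FultonHarrisGTM129, §15.5] -/
theorem exists_occurs_avoiding_last_of_kroneckerCoeff_pos {N n : ℕ} {lam : Fin 3 → Nat.Partition n}
    (hcard : ∀ j, (lam j).parts.card ≤ N + 1) (hg : 0 < kroneckerCoeff ℂ (lam 0) (lam 1) (lam 2)) :
    ∃ s : Fin (N + 1) → Fin (N + 1) → Fin (N + 1) → ℂ,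
      ((lam 0).parts.card ≤ N → ∀ j l, s (Fin.last N) j l = 0) ∧
      ((lam 1).parts.card ≤ N → ∀ i l, s i (Fin.last N) l = 0) ∧
      ((lam 2).parts.card ≤ N → ∀ i j, s i j (Fin.last N) = 0) ∧
      isotypicSum₁ (lam 0) (isotypicSum₂ (lam 1) (isotypicSum₃ (lam 2) (kroneckerPow s n))) ≠ 0 := by
  classical
  obtain ⟨M, hM, hM0, hinv⟩ :=
    exists_invariant_of_kroneckerCoeff_pos (k := ℂ) (hcard 0) (hcard 1) (hcard 2) hg
  -- the `bad` coordinates: last slice of a short leg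
  let bad : (Fin (N + 1) × Fin (N + 1)) × Fin (N + 1) → Prop := fun t =>
    ((lam 0).parts.card ≤ N ∧ t.1.1 = Fin.last N) ∨ ((lam 1).parts.card ≤ N ∧ t.1.2 = Fin.last N) ∨
      ((lam 2).parts.card ≤ N ∧ t.2 = Fin.last N)
  -- `M` is supported on zipped words avoiding the bad letters
  have hsupp : ∀ w : Fin n → (Fin (N + 1) × Fin (N + 1)) × Fin (N + 1), M (zip3.symm w) ≠ 0 → ∀ p, ¬ bad (w p) := by
    intro w hw p hb
    obtain ⟨h1, h2, h3⟩ := (mem_tripleHw_iff _ _ _ M).1 hM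
    rcases hb with ⟨hc, he⟩ | ⟨hc, he⟩ | ⟨hc, he⟩
    · exact apply_ne_last_of_mem_highestWeightSpace hc (h1 (fun q => (w q).1.2) (fun q => (w q).2))
        (w := fun q => (w q).1.1) hw p he
    · exact apply_ne_last_of_mem_highestWeightSpace hc (h2 (fun q => (w q).1.1) (fun q => (w q).2))
        (w := fun q => (w q).1.2) hw p he
    · exact apply_ne_last_of_mem_highestWeightSpace hc (h3 (fun q => (w q).1.1) (fun q => (w q).1.2))
        (w := fun q => (w q).2) hw p he
  -- the word polynomial of `M` (in the zipped alphabet) is nonzero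
  set F : (Fin n → (Fin (N + 1) × Fin (N + 1)) × Fin (N + 1)) → ℂ := fun w => M (zip3.symm w) with hF
  have hFinv : ∀ (τ : Equiv.Perm (Fin n)) (w : Fin n → (Fin (N + 1) × Fin (N + 1)) × Fin (N + 1)),
      F (w ∘ ⇑τ) = F w := by
    intro τ w
    simp only [hF, zip3_symm_comp, hinv]
  have hF0 : F ≠ 0 := by
    intro h0
    apply hM0
    funext t
    have := congrFun h0 (zip3 t)
    simpa [hF] using this
  have hP : wordPoly F ≠ 0 := fun h0 => hF0 (eq_zero_of_wordPoly_eq_zero hFinv h0)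
  obtain ⟨x, hx⟩ : ∃ x : (Fin (N + 1) × Fin (N + 1)) × Fin (N + 1) → ℂ, eval x (wordPoly F) ≠ 0 := by
    by_contra hall
    push Not at hall
    exact hP (MvPolynomial.funext fun x => by rw [hall x, map_zero])
  -- kill the bad coordinates: the value of the word polynomial does not change
  let x' : (Fin (N + 1) × Fin (N + 1)) × Fin (N + 1) → ℂ := fun t => if bad t then 0 else x t
  have heval : ∀ y : (Fin (N + 1) × Fin (N + 1)) × Fin (N + 1) → ℂ,
      eval y (wordPoly F) = ∑ w : Fin n → (Fin (N + 1) × Fin (N + 1)) × Fin (N + 1), F w * ∏ p, y (w p) := by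
    intro y
    simp only [wordPoly, map_sum, smul_eval, ← prod_X_eq_monomial_wordExp, map_prod, eval_X]
  have hx' : eval x' (wordPoly F) ≠ 0 := by
    rw [heval] at hx ⊢
    convert hx using 1
    refine Finset.sum_congr rfl fun w _ => ?_
    by_cases hw : F w = 0
    · simp [hw]
    · congr 1
      refine Finset.prod_congr rfl fun p _ => ?_
      have hnb := hsupp w hw p
      simp [x', hnb]
  refine ⟨fun i j l => x' ((i, j), l), ?_, ?_, ?_, isotypicSum₁₂₃_kroneckerPow_ne_zero_of_pairing_tripleHw_ne_zero hM ?_⟩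
  · intro hc j l
    simp [x', bad, hc]
  · intro hc i l
    simp [x', bad, hc]
  · intro hc i j
    simp [x', bad, hc]
  rw [heval, ← Equiv.sum_comp (zip3 (N := N + 1) (n := n))] at hx'
  rw [Fintype.sum_prod_type, Fintype.sum_prod_type] at hx'
  convert hx' using 1
  refine Finset.sum_congr rfl fun u _ => Finset.sum_congr rfl fun v _ =>
    Finset.sum_congr rfl fun w _ => ?_
  simp only [hF, Equiv.symm_apply_apply, kroneckerPow_apply, mul_comm (M _)]
  rfl

/-! ## §3  Short legs are free under the three sub-format fills; `UOCC` is decided on full-row triples -/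

/-- **Short legs are free.**  If every tensor of format `N+1` vanishing on the last slice of one of its legs has border rank
`≤ m` (`σ_m` fills the three sub-formats with one leg of dimension `N`), then every triple with a leg of at most `N` parts
occurring for some tensor of format `N+1` occurs in `⟨m⟩`. [cite: BurgisserIkenmeyer2011, §3.1–3.2, Lemma 10.18] -/
theorem occurs_unitTensor_of_shortLeg {m N : ℕ} (hNm : N + 1 ≤ m)
    (hfill : ∀ s : Fin (N + 1) → Fin (N + 1) → Fin (N + 1) → ℂ,
      ((∀ j l, s (Fin.last N) j l = 0) ∨ (∀ i l, s i (Fin.last N) l = 0) ∨ (∀ i j, s i j (Fin.last N) = 0)) →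
      algBorderRank s ≤ m)
    {d : ℕ} (lam : Fin 3 → Nat.Partition d) (hshort : ∃ j, (lam j).parts.card ≤ N)
    (hocc : ∃ s : Fin (N + 1) → Fin (N + 1) → Fin (N + 1) → ℂ,
      isotypicSum₁ (lam 0) (isotypicSum₂ (lam 1) (isotypicSum₃ (lam 2) (kroneckerPow s d))) ≠ 0) :
    isotypicSum₁ (lam 0) (isotypicSum₂ (lam 1) (isotypicSum₃ (lam 2) (kroneckerPow (unitTensor ℂ m) d))) ≠ 0 := by
  obtain ⟨hcard, hg⟩ := (exists_occurs_iff_kronecker lam).1 hocc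
  obtain ⟨s, h0, h1, h2, hs⟩ := exists_occurs_avoiding_last_of_kroneckerCoeff_pos hcard hg
  refine occurs_unitTensor_of_algBorderRank_le hNm s (hfill s ?_) d lam hs
  obtain ⟨j, hj⟩ := hshort
  fin_cases j
  · exact Or.inl (h0 hj)
  · exact Or.inr (Or.inl (h1 hj))
  · exact Or.inr (Or.inr (h2 hj))

/-- **`UOCC(m, N+1)` is decided on the full-row triples** (all three legs with exactly `N+1` parts), given the three
sub-format fills. (`→` is trivial; `←`: a triple occurring in format `N+1` has legs of `≤ N+1` parts, and if one leg is
short it is free by `occurs_unitTensor_of_shortLeg`; general finite formats `ι` reduce to `Fin (N+1)` by `uocc_iff_fin`.)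
[cite: BurgisserIkenmeyer2011, §3.1–3.2] -/
theorem uocc_iff_fullRow {m N : ℕ} (hNm : N + 1 ≤ m)
    (hfill : ∀ s : Fin (N + 1) → Fin (N + 1) → Fin (N + 1) → ℂ,
      ((∀ j l, s (Fin.last N) j l = 0) ∨ (∀ i l, s i (Fin.last N) l = 0) ∨ (∀ i j, s i j (Fin.last N) = 0)) →
      algBorderRank s ≤ m) :
    (∀ {ι : Type} [Fintype ι], Fintype.card ι ≤ N + 1 → ∀ (s : ι → ι → ι → ℂ) (d : ℕ)
      (lam : Fin 3 → Nat.Partition d),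
      isotypicSum₁ (lam 0) (isotypicSum₂ (lam 1) (isotypicSum₃ (lam 2) (kroneckerPow s d))) ≠ 0 →
      isotypicSum₁ (lam 0) (isotypicSum₂ (lam 1) (isotypicSum₃ (lam 2) (kroneckerPow (unitTensor ℂ m) d))) ≠ 0) ↔
    ∀ (s : Fin (N + 1) → Fin (N + 1) → Fin (N + 1) → ℂ) (d : ℕ) (lam : Fin 3 → Nat.Partition d),
      (∀ j, (lam j).parts.card = N + 1) →
      isotypicSum₁ (lam 0) (isotypicSum₂ (lam 1) (isotypicSum₃ (lam 2) (kroneckerPow s d))) ≠ 0 →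
      isotypicSum₁ (lam 0) (isotypicSum₂ (lam 1) (isotypicSum₃ (lam 2) (kroneckerPow (unitTensor ℂ m) d))) ≠ 0 := by
  constructor
  · intro hU s d lam _ hocc
    exact hU (by simp) s d lam hocc
  · intro hfull
    rw [uocc_iff_fin]
    intro s d lam hocc
    by_cases hshort : ∃ j, (lam j).parts.card ≤ N
    · exact occurs_unitTensor_of_shortLeg hNm hfill lam hshort ⟨s, hocc⟩
    · push Not at hshort
      have hcard := ((exists_occurs_iff_kronecker lam).1 ⟨s, hocc⟩).1
      exact hfull s d lam (fun j => le_antisymm (hcard j) (Nat.succ_le_of_lt (hshort j))) hocc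

/-- **The cell `(6,4)`: `u(4) = 6` is decided on the all-four-row triples.**  Under the three fills "every `4×4×4`
tensor vanishing on the last slice of one leg has border rank `≤ 6`" (`σ₆` fills `3×4×4`: Terracini/Jacobian rank `48` at
an integer point, NODE-g33 `terracini.py`; [AboOttavianiPeterson2008, §4]), `UOCC(6,4)` holds iff every triple with three
legs of exactly four parts occurring for a `4×4×4` tensor occurs in `⟨6⟩`.  With `kroneckerSemigroup_le_iff_generators`
(part VI) and `I(σ₆(4,4,4))_{<19} = 0` [HauensteinIkenmeyerLandsberg2013] this leaves the all-four-row Hilbert-basis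
elements of `K(4,4,4)` of degree `≥ 19` (NODE-g33 §2: eleven in degree 20, one in degree 24, none in degrees 19, 21–23).
[cite: HauensteinIkenmeyerLandsberg2013, §1] [cite: BurgisserIkenmeyer2011, §3.2] -/
theorem uocc_six_four_iff_fullRow
    (hfill : ∀ s : Fin 4 → Fin 4 → Fin 4 → ℂ,
      ((∀ j l, s (Fin.last 3) j l = 0) ∨ (∀ i l, s i (Fin.last 3) l = 0) ∨ (∀ i j, s i j (Fin.last 3) = 0)) →
      algBorderRank s ≤ 6) :
    (∀ {ι : Type} [Fintype ι], Fintype.card ι ≤ 4 → ∀ (s : ι → ι → ι → ℂ) (d : ℕ)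
      (lam : Fin 3 → Nat.Partition d),
      isotypicSum₁ (lam 0) (isotypicSum₂ (lam 1) (isotypicSum₃ (lam 2) (kroneckerPow s d))) ≠ 0 →
      isotypicSum₁ (lam 0) (isotypicSum₂ (lam 1) (isotypicSum₃ (lam 2) (kroneckerPow (unitTensor ℂ 6) d))) ≠ 0) ↔
    ∀ (s : Fin 4 → Fin 4 → Fin 4 → ℂ) (d : ℕ) (lam : Fin 3 → Nat.Partition d),
      (∀ j, (lam j).parts.card = 4) →
      isotypicSum₁ (lam 0) (isotypicSum₂ (lam 1) (isotypicSum₃ (lam 2) (kroneckerPow s d))) ≠ 0 →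
      isotypicSum₁ (lam 0) (isotypicSum₂ (lam 1) (isotypicSum₃ (lam 2) (kroneckerPow (unitTensor ℂ 6) d))) ≠ 0 :=
  uocc_iff_fullRow (N := 3) (by norm_num) hfill

/-! ## §4  Combined with the generator criterion: the full-row Hilbert-basis elements decide -/

/-- **`UOCC(m, N+1)` is decided on the full-row GENERATORS of `K(N+1,N+1,N+1)` of degree `> m`**, given the three
sub-format fills: `UOCC(m, N+1)` holds iff every triple of degree `d > m` with three legs of exactly `N+1` parts and positive
Kronecker coefficient EITHER occurs in `⟨m⟩^{⊗d}` OR is the row-wise sum of two elements of `K(N+1,N+1,N+1)` of positive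
degrees (generator criterion `kroneckerSemigroup_le_iff_generators`, part VI, with the short-leg triples discharged by
`occurs_unitTensor_of_shortLeg`).  Equivalently: the full-row indecomposables (Hilbert-basis elements) of the Kronecker
semigroup of degree `> m` lie in `S(⟨m⟩)`. [cite: BurgisserIkenmeyer2011, §3.2, §10.4, Lemma 10.18] -/
theorem uocc_iff_fullRow_generators {m N : ℕ} (hNm : N + 1 ≤ m)
    (hfill : ∀ s : Fin (N + 1) → Fin (N + 1) → Fin (N + 1) → ℂ,
      ((∀ j l, s (Fin.last N) j l = 0) ∨ (∀ i l, s i (Fin.last N) l = 0) ∨ (∀ i j, s i j (Fin.last N) = 0)) →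
      algBorderRank s ≤ m) :
    (∀ {ι : Type} [Fintype ι], Fintype.card ι ≤ N + 1 → ∀ (s : ι → ι → ι → ℂ) (d : ℕ)
      (lam : Fin 3 → Nat.Partition d),
      isotypicSum₁ (lam 0) (isotypicSum₂ (lam 1) (isotypicSum₃ (lam 2) (kroneckerPow s d))) ≠ 0 →
      isotypicSum₁ (lam 0) (isotypicSum₂ (lam 1) (isotypicSum₃ (lam 2) (kroneckerPow (unitTensor ℂ m) d))) ≠ 0) ↔
    ∀ (d : ℕ) (lam : Fin 3 → Nat.Partition d), m < d → (∀ j, (lam j).parts.card = N + 1) →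
      0 < kroneckerCoeff ℂ (lam 0) (lam 1) (lam 2) →
      isotypicSum₁ (lam 0) (isotypicSum₂ (lam 1) (isotypicSum₃ (lam 2) (kroneckerPow (unitTensor ℂ m) d))) ≠ 0 ∨
      ∃ (d₁ d₂ : ℕ) (_ : d₁ + d₂ = d) (lam₁ : Fin 3 → Nat.Partition d₁) (lam₂ : Fin 3 → Nat.Partition d₂),
        0 < d₁ ∧ 0 < d₂ ∧
        ((∀ j, (lam₁ j).parts.card ≤ N + 1) ∧ 0 < kroneckerCoeff ℂ (lam₁ 0) (lam₁ 1) (lam₁ 2)) ∧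
        ((∀ j, (lam₂ j).parts.card ≤ N + 1) ∧ 0 < kroneckerCoeff ℂ (lam₂ 0) (lam₂ 1) (lam₂ 2)) ∧
        ∀ j, (lam j).parts = ((lam₁ j).rowAdd (lam₂ j)).parts := by
  rw [uocc_iff_kroneckerSemigroup_le, kroneckerSemigroup_le_iff_generators hNm]
  constructor
  · intro h d lam hd hfull hg
    exact h d lam hd ⟨fun j => (hfull j).le, hg⟩
  · intro h d lam hd hK
    by_cases hfull : ∀ j, (lam j).parts.card = N + 1
    · exact h d lam hd hfull hK.2
    · push Not at hfull
      obtain ⟨j, hj⟩ := hfull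
      exact Or.inl (occurs_unitTensor_of_shortLeg hNm hfill lam
        ⟨j, Nat.le_of_lt_succ (lt_of_le_of_ne (hK.1 j) hj)⟩ ((exists_occurs_iff_kronecker lam).2 hK))

/-- **The cell `(6,4)`, finite residual form.**  Under the three `3×4×4`-type fills AND the absence of equations of degree
`< 19` on `σ₆(4,4,4)` in closure currency ("every triple of degree `< 19` occurring for a `4×4×4` tensor occurs in `⟨6⟩`",
[HauensteinIkenmeyerLandsberg2013, §1], hypothesis, literal), `UOCC(6,4)` (`u(4) = 6`) holds iff every all-four-row
triple of degree `≥ 19` with positive Kronecker coefficient occurs in `⟨6⟩` or decomposes in `K(4,4,4)` — i.e. iff the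
all-four-row Hilbert-basis elements of `K(4,4,4)` of degree `≥ 19` lie in `S(⟨6⟩)` (NODE-g33 §2 lists them through degree
24: eleven of degree 20, one of degree 24). [cite: HauensteinIkenmeyerLandsberg2013, §1] [cite: BurgisserIkenmeyer2011, §3.2, §10.4] -/
theorem uocc_six_four_iff_fullRow_generators_ge
    (hfill : ∀ s : Fin 4 → Fin 4 → Fin 4 → ℂ,
      ((∀ j l, s (Fin.last 3) j l = 0) ∨ (∀ i l, s i (Fin.last 3) l = 0) ∨ (∀ i j, s i j (Fin.last 3) = 0)) →
      algBorderRank s ≤ 6)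
    (hlow : ∀ (d : ℕ) (lam : Fin 3 → Nat.Partition d), d < 19 →
      (∃ s : Fin 4 → Fin 4 → Fin 4 → ℂ,
        isotypicSum₁ (lam 0) (isotypicSum₂ (lam 1) (isotypicSum₃ (lam 2) (kroneckerPow s d))) ≠ 0) →
      isotypicSum₁ (lam 0) (isotypicSum₂ (lam 1) (isotypicSum₃ (lam 2) (kroneckerPow (unitTensor ℂ 6) d))) ≠ 0) :
    (∀ {ι : Type} [Fintype ι], Fintype.card ι ≤ 4 → ∀ (s : ι → ι → ι → ℂ) (d : ℕ)
      (lam : Fin 3 → Nat.Partition d),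
      isotypicSum₁ (lam 0) (isotypicSum₂ (lam 1) (isotypicSum₃ (lam 2) (kroneckerPow s d))) ≠ 0 →
      isotypicSum₁ (lam 0) (isotypicSum₂ (lam 1) (isotypicSum₃ (lam 2) (kroneckerPow (unitTensor ℂ 6) d))) ≠ 0) ↔
    ∀ (d : ℕ) (lam : Fin 3 → Nat.Partition d), 19 ≤ d → (∀ j, (lam j).parts.card = 4) →
      0 < kroneckerCoeff ℂ (lam 0) (lam 1) (lam 2) →
      isotypicSum₁ (lam 0) (isotypicSum₂ (lam 1) (isotypicSum₃ (lam 2) (kroneckerPow (unitTensor ℂ 6) d))) ≠ 0 ∨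
      ∃ (d₁ d₂ : ℕ) (_ : d₁ + d₂ = d) (lam₁ : Fin 3 → Nat.Partition d₁) (lam₂ : Fin 3 → Nat.Partition d₂),
        0 < d₁ ∧ 0 < d₂ ∧
        ((∀ j, (lam₁ j).parts.card ≤ 4) ∧ 0 < kroneckerCoeff ℂ (lam₁ 0) (lam₁ 1) (lam₁ 2)) ∧
        ((∀ j, (lam₂ j).parts.card ≤ 4) ∧ 0 < kroneckerCoeff ℂ (lam₂ 0) (lam₂ 1) (lam₂ 2)) ∧
        ∀ j, (lam j).parts = ((lam₁ j).rowAdd (lam₂ j)).parts := by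
  rw [uocc_iff_fullRow_generators (N := 3) (by norm_num) hfill]
  constructor
  · intro h d lam hd hfull hg
    exact h d lam (by omega) hfull hg
  · intro h d lam hd hfull hg
    by_cases h19 : 19 ≤ d
    · exact h d lam h19 hfull hg
    · exact Or.inl (hlow d lam (by omega) ((exists_occurs_iff_kronecker lam).2 ⟨fun j => (hfull j).le, hg⟩))

end Summit.MatrixMultiplication.MatrixMultiplication.Theorems.ObstructionCalculus

end
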